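import Summits.Ventures.PercRepro.MSTightPartnerNonemptyBasic

/-!
# An empty partner family at a tightening direction: the case `ρ ∈ F₁`

Dossier proofs/MINE1-theoremS.md, Addendum 55. Setting of MSTightPartnerNonemptyBasic.lean; the
mirror of MSTightPartnerNonemptyCore.lean's case `ρ ∈ F₀`, with `q ∩ ρ` in place of `q ∪ ρ`, `F₀`
and `F₁` exchanged, the empty core replaced by the full support, and the canonical realisation
`z = (z ∪ ρ) \ (ρ \ z)` read from the right:

* `mem_part0_iff_inter_Rstar_mem_part0`: for `ρ ⊄ q`, `q ∈ F₀ ↔ q ∩ ρ ∈ F₀`;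
* `mem_partr_of_Rstar_subset`: if some `r`-free member lies inside `ρ`, every member containing `ρ`
  is an `r`-member (an `r`-free member containing `ρ` shrinks to `ρ` through the full support,
  `sdiff_union_Rstar_mem_part0`);
* `false_of_Rstar_mem_partr_of_exists`: ... and then `∅ ∈ Y` is impossible;
* `false_of_Rstar_mem_partr_of_forall`: if no `r`-free member lies inside `ρ`, every `r`-free
  member contains `ρ` and every member not containing `ρ` — against `univ.erase r ∉ P`;
* `false_of_Rstar_mem_partr`: the case `ρ ∈ F₁` is impossible.
-/

namespace PercRepro.MSTight

open Finset
open scoped FinsetFamily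

variable {α : Type*} [DecidableEq α] [Fintype α]

section CaseOne

variable {r : α} {F : Finset (Finset α)}

/-- **Case `ρ ∈ F₁`, (a).** A member not containing `ρ` is `r`-free iff `q ∩ ρ` is. -/
theorem mem_part0_iff_inter_Rstar_mem_part0 (hP : Tight (proj r F))
    (hXY : diffsX r F ∩ diffsY r F = {∅}) (hρ1 : Rstar (proj r F) ∈ partr r F) {q : Finset α}
    (hq : q ∈ proj r F) (hqρ : ¬ Rstar (proj r F) ⊆ q) :
    q ∈ part0 r F ↔ q ∩ Rstar (proj r F) ∈ part0 r F := by
  have hρ : Rstar (proj r F) ∈ proj r F := mem_proj_of_mem_partr hρ1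
  have hz : Rstar (proj r F) \ q ≠ ∅ := fun h => hqρ (sdiff_eq_empty_iff_subset.1 h)
  have hqρP : q ∩ Rstar (proj r F) ∈ proj r F := inter_Rstar_mem hP hq
  have e : Rstar (proj r F) \ (q ∩ Rstar (proj r F)) = Rstar (proj r F) \ q :=
    sdiff_inter_right_eq_sdiff
  constructor
  · intro hq0
    have hY : Rstar (proj r F) \ q ∈ diffsY r F := sdiff_mem_diffsY_of_partr_part0 hρ1 hq0
    rw [← e] at hY hz
    exact mem_part0_of_sdiff_mem_diffsY hXY hρ hqρP hz hY
  · intro hq0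
    have hY : Rstar (proj r F) \ (q ∩ Rstar (proj r F)) ∈ diffsY r F :=
      sdiff_mem_diffsY_of_partr_part0 hρ1 hq0
    rw [e] at hY
    exact mem_part0_of_sdiff_mem_diffsY hXY hρ hq hz hY

/-- **Case `ρ ∈ F₁`, (b) step.** With an `r`-free member `b ⊆ ρ`, an `r`-free member `a ⊇ ρ`
shrinks to the `r`-free member `(a \ c) ∪ ρ` for every member `c ⊇ ρ`. -/
theorem sdiff_union_Rstar_mem_part0 (hP : Tight (proj r F)) (hK : partner r F = ∅)
    (hXY : diffsX r F ∩ diffsY r F = {∅}) (hρ1 : Rstar (proj r F) ∈ partr r F) {b : Finset α}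
    (hb : b ∈ part0 r F) (hbρ : b ⊆ Rstar (proj r F)) {a : Finset α} (ha : a ∈ part0 r F)
    (hρa : Rstar (proj r F) ⊆ a) {c : Finset α} (hc : c ∈ proj r F)
    (hρc : Rstar (proj r F) ⊆ c) : (a \ c) ∪ Rstar (proj r F) ∈ part0 r F := by
  have hρ : Rstar (proj r F) ∈ proj r F := mem_proj_of_mem_partr hρ1
  have haP : a ∈ proj r F := mem_proj_of_mem_part0 ha
  have hbP : b ∈ proj r F := mem_proj_of_mem_part0 hb
  have hbρ' : b ≠ Rstar (proj r F) := fun h => not_mem_partr_of_mem_part0 hK hb (h ▸ hρ1)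
  have hw0 : Rstar (proj r F) \ b ≠ ∅ := fun h =>
    hbρ' (Subset.antisymm hbρ (sdiff_eq_empty_iff_subset.1 h))
  obtain ⟨x₀, hx₀⟩ := nonempty_iff_ne_empty.2 hw0
  -- `q' := (c \ ρ) ∪ b` is `r`-free, because `q' ∩ ρ = b`
  have hq'P : (c \ Rstar (proj r F)) ∪ b ∈ proj r F := by
    have h := sdiff_Rstar_union_inter_Rstar_mem hP hc hbP
    rwa [inter_eq_left.2 hbρ] at h
  have hq'ρ : ¬ Rstar (proj r F) ⊆ (c \ Rstar (proj r F)) ∪ b := by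
    intro h
    rcases mem_union.1 (h (mem_sdiff.1 hx₀).1) with h' | h'
    · exact (mem_sdiff.1 h').2 (mem_sdiff.1 hx₀).1
    · exact (mem_sdiff.1 hx₀).2 h'
  have hq'0 : (c \ Rstar (proj r F)) ∪ b ∈ part0 r F := by
    rw [mem_part0_iff_inter_Rstar_mem_part0 hP hXY hρ1 hq'P hq'ρ, sdiff_union_inter_eq_of_subset hbρ]
    exact hb
  -- `a' := (a \ c) ∪ ρ` is a member
  have ha'P : (a \ c) ∪ Rstar (proj r F) ∈ proj r F := by
    rw [mem_iff_parts hP, sdiff_union_sdiff_eq_sdiff_of_subset hρc, sdiff_union_right_self_eq_empty]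
    exact ⟨mem_diffs.2 ⟨a, haP, c, hc, rfl⟩,
      mem_diffs.2 ⟨Rstar (proj r F), hρ, Rstar (proj r F), hρ, Finset.sdiff_self _⟩⟩
  -- `a \ q' = a' \ b` is a nonempty difference of two `r`-free members, hence not of type I
  have hzne : a \ ((c \ Rstar (proj r F)) ∪ b) ≠ ∅ := by
    intro h
    have h' := sdiff_eq_empty_iff_subset.1 h (hρa (mem_sdiff.1 hx₀).1)
    rcases mem_union.1 h' with h'' | h''
    · exact (mem_sdiff.1 h'').2 (mem_sdiff.1 hx₀).1
    · exact (mem_sdiff.1 hx₀).2 h''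
  have hnY : a \ ((c \ Rstar (proj r F)) ∪ b) ∉ diffsY r F :=
    sdiff_notMem_diffsY_of_part0_left hXY ha hq'P hzne
  rw [sdiff_sdiff_union_eq_sdiff_union_sdiff_of_subset hρa hρc hbρ] at hnY
  exact mem_part0_of_sdiff_notMem_diffsY ha'P hb hnY

/-- **Case `ρ ∈ F₁`, (b).** If some `r`-free member lies inside `ρ`, every member containing `ρ`
is an `r`-member (the full support shrinks an `r`-free member containing `ρ` down to `ρ`). -/
theorem mem_partr_of_Rstar_subset (hP : Tight (proj r F)) (hK : partner r F = ∅)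
    (hXY : diffsX r F ∩ diffsY r F = {∅}) (hρ1 : Rstar (proj r F) ∈ partr r F)
    (hsupp : ∀ a, a ≠ r → ∃ p ∈ proj r F, a ∈ p) {b : Finset α} (hb : b ∈ part0 r F)
    (hbρ : b ⊆ Rstar (proj r F)) :
    ∀ a ∈ proj r F, Rstar (proj r F) ⊆ a → a ∈ partr r F := by
  suffices h : ∀ k : ℕ, ∀ a ∈ proj r F, Rstar (proj r F) ⊆ a →
      (a \ Rstar (proj r F)).card = k → a ∈ partr r F from
    fun a ha hρa => h _ a ha hρa rfl
  intro k
  induction k using Nat.strong_induction_on with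
  | _ k ih =>
  intro a ha hρa hk
  by_contra ha1
  have ha0 : a ∈ part0 r F := mem_part0_of_notMem_partr ha ha1
  have haρ : a ≠ Rstar (proj r F) := fun h => not_mem_partr_of_mem_part0 hK ha0 (h ▸ hρ1)
  obtain ⟨n, hna, hnρ⟩ : ∃ n ∈ a, n ∉ Rstar (proj r F) := by
    by_contra hcon
    push Not at hcon
    exact haρ (Subset.antisymm hcon hρa)
  have hnr : n ≠ r := fun h => notMem_of_mem_proj ha (h ▸ hna)
  obtain ⟨p, hp, hnp⟩ := hsupp n hnr
  have hcP : p ∪ Rstar (proj r F) ∈ proj r F := mem_union_Rstar_of_mem hP hp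
  have hρc : Rstar (proj r F) ⊆ p ∪ Rstar (proj r F) := subset_union_right
  have ha' : (a \ (p ∪ Rstar (proj r F))) ∪ Rstar (proj r F) ∈ part0 r F :=
    sdiff_union_Rstar_mem_part0 hP hK hXY hρ1 hb hbρ ha0 hρa hcP hρc
  have hρa' : Rstar (proj r F) ⊆ (a \ (p ∪ Rstar (proj r F))) ∪ Rstar (proj r F) :=
    subset_union_right
  have hlt : (((a \ (p ∪ Rstar (proj r F))) ∪ Rstar (proj r F)) \ Rstar (proj r F)).card < k := by
    rw [← hk, union_sdiff_right]
    apply card_lt_card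
    rw [ssubset_iff_of_subset (sdiff_subset_sdiff sdiff_subset (Subset.refl _))]
    refine ⟨n, mem_sdiff.2 ⟨hna, hnρ⟩, fun h => ?_⟩
    exact (mem_sdiff.1 (mem_sdiff.1 h).1).2 (mem_union_left _ hnp)
  exact not_mem_partr_of_mem_part0 hK ha' (ih _ hlt _ (mem_proj_of_mem_part0 ha') hρa' rfl)

/-- **Case `ρ ∈ F₁`, (c).** With an `r`-free member inside `ρ`, no `r`-member lies inside an
`r`-free member: `∅ ∉ Y`. -/
theorem false_of_Rstar_mem_partr_of_exists (hP : Tight (proj r F)) (hK : partner r F = ∅)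
    (hXY : diffsX r F ∩ diffsY r F = {∅}) (hρ1 : Rstar (proj r F) ∈ partr r F)
    (hS : univ.erase r ∉ proj r F) (hsupp : ∀ a, a ≠ r → ∃ p ∈ proj r F, a ∈ p) {b : Finset α}
    (hb : b ∈ part0 r F) (hbρ : b ⊆ Rstar (proj r F)) (h0 : (∅ : Finset α) ∈ diffsY r F) :
    False := by
  obtain ⟨t, ht, s, hs, hts⟩ := mem_diffs.1 h0
  have hts' : t ⊆ s := sdiff_eq_empty_iff_subset.1 hts
  have hρ : Rstar (proj r F) ∈ proj r F := mem_proj_of_mem_partr hρ1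
  have htP : t ∈ proj r F := mem_proj_of_mem_partr ht
  have hsP : s ∈ proj r F := mem_proj_of_mem_part0 hs
  have hρs : ¬ Rstar (proj r F) ⊆ s := fun h =>
    not_mem_partr_of_mem_part0 hK hs (mem_partr_of_Rstar_subset hP hK hXY hρ1 hsupp hb hbρ s hsP h)
  have hρt : ¬ Rstar (proj r F) ⊆ t := fun h => hρs (h.trans hts')
  have hsρ0 : s ∩ Rstar (proj r F) ∈ part0 r F :=
    (mem_part0_iff_inter_Rstar_mem_part0 hP hXY hρ1 hsP hρs).1 hs
  have htρ1 : t ∩ Rstar (proj r F) ∈ partr r F := by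
    have h : t ∩ Rstar (proj r F) ∉ part0 r F := fun h =>
      not_mem_partr_of_mem_part0 hK
        ((mem_part0_iff_inter_Rstar_mem_part0 hP hXY hρ1 htP hρt).2 h) ht
    exact mem_partr_of_notMem_part0 (inter_Rstar_mem hP htP) h
  -- a member `d ⊋ ρ` from `univ.erase r ∉ P` and the full support
  obtain ⟨q, hq, hqρ⟩ := exists_mem_not_subset_Rstar hP hS hsupp ⟨s, hsP⟩
  have hdP : q ∪ Rstar (proj r F) ∈ proj r F := mem_union_Rstar_of_mem hP hq
  have hdρ : (q ∪ Rstar (proj r F)) \ Rstar (proj r F) ≠ ∅ := by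
    rw [union_sdiff_right]
    exact fun h => hqρ (sdiff_eq_empty_iff_subset.1 h)
  -- `a := (d \ ρ) ∪ (t ∩ ρ)` is a member with `a \ (s ∩ ρ) = d \ ρ`
  have haP : ((q ∪ Rstar (proj r F)) \ Rstar (proj r F)) ∪ (t ∩ Rstar (proj r F)) ∈ proj r F :=
    sdiff_Rstar_union_inter_Rstar_mem hP hdP htP
  have hnY : (q ∪ Rstar (proj r F)) \ Rstar (proj r F) ∉ diffsY r F :=
    sdiff_notMem_diffsY_of_partr_right hXY hdP hρ1 hdρ
  rw [← sdiff_union_inter_sdiff_inter_eq_of_subset hts'] at hnY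
  have ha0 : ((q ∪ Rstar (proj r F)) \ Rstar (proj r F)) ∪ (t ∩ Rstar (proj r F)) ∈ part0 r F :=
    mem_part0_of_sdiff_notMem_diffsY haP hsρ0 hnY
  have hρa : ¬ Rstar (proj r F) ⊆
      ((q ∪ Rstar (proj r F)) \ Rstar (proj r F)) ∪ (t ∩ Rstar (proj r F)) := by
    intro h
    apply hρt
    intro x hx
    rcases mem_union.1 (h hx) with h' | h'
    · exact absurd hx (mem_sdiff.1 h').2
    · exact (mem_inter.1 h').1
  have h := (mem_part0_iff_inter_Rstar_mem_part0 hP hXY hρ1 haP hρa).1 ha0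
  rw [sdiff_union_inter_inter_eq] at h
  exact not_mem_partr_of_mem_part0 hK h htρ1

/-- **Case `ρ ∈ F₁`, (d).** If no `r`-free member lies inside `ρ`, every `r`-free member contains
`ρ` and contains every member not containing `ρ` — impossible with `univ.erase r ∉ P`. -/
theorem false_of_Rstar_mem_partr_of_forall (hP : Tight (proj r F))
    (hXY : diffsX r F ∩ diffsY r F = {∅}) (hρ1 : Rstar (proj r F) ∈ partr r F)
    (hE : (∅ : Finset α) ∉ proj r F) (hcore : ∀ a, ∃ p ∈ proj r F, a ∉ p)
    (hS : univ.erase r ∉ proj r F) (hsupp : ∀ a, a ≠ r → ∃ p ∈ proj r F, a ∈ p)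
    (hne : (part0 r F).Nonempty) (hno : ∀ b ∈ part0 r F, ¬ b ⊆ Rstar (proj r F)) : False := by
  obtain ⟨a, ha⟩ := hne
  have haP : a ∈ proj r F := mem_proj_of_mem_part0 ha
  have hρ : Rstar (proj r F) ∈ proj r F := mem_proj_of_mem_partr hρ1
  have hρa : Rstar (proj r F) ⊆ a := by
    by_contra h
    exact hno _ ((mem_part0_iff_inter_Rstar_mem_part0 hP hXY hρ1 haP h).1 ha) inter_subset_right
  -- every member not containing `ρ` is an `r`-member and lies inside `a`
  have hsub : ∀ q ∈ proj r F, ¬ Rstar (proj r F) ⊆ q → q ⊆ a := by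
    intro q hq hρq
    have hq1 : q ∈ partr r F :=
      mem_partr_of_notMem_part0 hq (fun h =>
        hno _ ((mem_part0_iff_inter_Rstar_mem_part0 hP hXY hρ1 hq hρq).1 h) inter_subset_right)
    have hY : q \ a ∈ diffsY r F := sdiff_mem_diffsY_of_partr_part0 hq1 ha
    have hwP : (q \ a) ∪ Rstar (proj r F) ∈ proj r F :=
      union_Rstar_mem_of_mem_diffs hP (mem_diffs.2 ⟨q, hq, a, haP, rfl⟩)
    have e : ((q \ a) ∪ Rstar (proj r F)) \ Rstar (proj r F) = q \ a :=
      sdiff_union_sdiff_eq_sdiff_of_subset' hρa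
    by_contra hqa
    have hne' : q \ a ≠ ∅ := fun h => hqa (sdiff_eq_empty_iff_subset.1 h)
    have h := sdiff_notMem_diffsY_of_partr_right hXY hwP hρ1 (by rw [e]; exact hne')
    rw [e] at h
    exact h hY
  -- an element `n ≠ r` outside `a`, a member through it, and a member `c ⊊ ρ`
  have hane : a ≠ univ.erase r := fun h => hS (h ▸ haP)
  obtain ⟨n, hn, hna⟩ : ∃ n ∈ univ.erase r, n ∉ a := by
    by_contra h
    push Not at h
    exact hane (Subset.antisymm
      (fun x hx => mem_erase.2 ⟨fun hxr => notMem_of_mem_proj haP (hxr ▸ hx), mem_univ x⟩) h)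
  obtain ⟨p, hp, hnp⟩ := hsupp n (mem_erase.1 hn).1
  obtain ⟨m, hm⟩ := nonempty_iff_ne_empty.2 (Rstar_proj_ne_empty hP hE ⟨a, haP⟩)
  obtain ⟨p', hp', hmp'⟩ := hcore m
  have hp''P : (p \ Rstar (proj r F)) ∪ (p' ∩ Rstar (proj r F)) ∈ proj r F :=
    sdiff_Rstar_union_inter_Rstar_mem hP hp hp'
  have hρp'' : ¬ Rstar (proj r F) ⊆ (p \ Rstar (proj r F)) ∪ (p' ∩ Rstar (proj r F)) := by
    intro h
    rcases mem_union.1 (h hm) with h' | h'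
    · exact (mem_sdiff.1 h').2 hm
    · exact hmp' (mem_inter.1 h').1
  have hnρ : n ∉ Rstar (proj r F) := fun h => hna (hρa h)
  exact hna (hsub _ hp''P hρp'' (mem_union_left _ (mem_sdiff.2 ⟨hnp, hnρ⟩)))

/-- **Case `ρ ∈ F₁` is impossible** (with `∅ ∈ Y`). -/
theorem false_of_Rstar_mem_partr (hP : Tight (proj r F)) (hK : partner r F = ∅)
    (hXY : diffsX r F ∩ diffsY r F = {∅}) (hρ1 : Rstar (proj r F) ∈ partr r F)
    (hE : (∅ : Finset α) ∉ proj r F) (hcore : ∀ a, ∃ p ∈ proj r F, a ∉ p)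
    (hS : univ.erase r ∉ proj r F) (hsupp : ∀ a, a ≠ r → ∃ p ∈ proj r F, a ∈ p)
    (h0 : (∅ : Finset α) ∈ diffsY r F) : False := by
  by_cases hex : ∃ b ∈ part0 r F, b ⊆ Rstar (proj r F)
  · obtain ⟨b, hb, hbρ⟩ := hex
    exact false_of_Rstar_mem_partr_of_exists hP hK hXY hρ1 hS hsupp hb hbρ h0
  · push Not at hex
    have hne : (part0 r F).Nonempty := by
      obtain ⟨-, -, s, hs, -⟩ := mem_diffs.1 h0
      exact ⟨s, hs⟩
    exact false_of_Rstar_mem_partr_of_forall hP hXY hρ1 hE hcore hS hsupp hne hex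

end CaseOne

end PercRepro.MSTight
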